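import Literature.NumberTheory.EllipticCurves.Kato2004.IwasawaH1ReductionSurjectiveProofs
import Literature.NumberTheory.EllipticCurves.Kato2004.LocPKernelRankOnePlumbing
import Literature.NumberTheory.GaloisRepresentations.ContinuousCorestriction
import Summits.BirchSwinnertonDyer.Rank1Residual.X11b.KummerLocalIndex
import HarnessLib

set_option autoImplicit false

/-!
# The `T_p`-adic GLOBAL KUMMER CLASS `κ_∞(P) ∈ H¹(ℚ, T_pW)` of a rational point `P ∈ W(ℚ)`: the unique class whose
# reduction modulo `p^k` is the level-`p^k` Kummer class `κ_{p^k}(P)` for every `k`; it is additive in `P`, and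
# `HasLocPKummerLog W p κ_∞(P) (log_ω P)` (seat `bsd-cm-prr-ty1` g9, cell `bsd-cm`; theorems only: no definition,
# no named fact, no instance, no `sorry`)

Part 12 of the seat's kernel cut of stub 3 `stub_rankOneCountReadingKato` of the Kato–Perrin-Riou skeletons v4 (cruxes
stmt-BirchSwinnertonDyer-19945 / -19223; = cell bsd-potss's held input 27322). Parts 8–11 reduced the display COUNT (7)
to the Euler-characteristic identity COUNT-EC⁰, whose right-hand side carries `2·v_p log_ω(P)` for a generator `P` of
`W(ℚ)/tors` and whose left-hand side measures `A = H¹(ℤ[1/p], T_pW) ∩ …` against the Kummer-logarithm functional `φ`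
(`HasLocPKummerLog`). The comparison object between the two sides is the `T_p`-ADIC KUMMER CLASS of `P` — the image of
`P` under `W(ℚ) → W(ℚ) ⊗ ℤ_p = lim← W(ℚ)/p^k ↪ lim← H¹(ℚ, W[p^k]) = H¹(ℚ, T_pW)` (Kato §14.1, the map
`E(ℚ) ⊗ ℤ_p → H¹(ℤ[1/p], T)`; Rubin, *Euler Systems*, §1.6.A; Perrin-Riou 1987 §0). The tree had the finite-level
Kummer maps `kummerMapTorsion W n` (AEC VIII.§2), the local Kummer maps and `HasLocPKummerLog` (Bloch–Kato Ex. 3.11 in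
finite-level currency), and Rubin B.2.3 `H¹(U, T_pW) ≅ lim←_k H¹(U, W[p^k])` (`Kato2004.exists_reduceH1Pk_eq_of_compatible`
/ `eq_of_forall_reduceH1Pk_eq`), but NOT the global `T_p`-adic class of a point. THIS FILE builds it (existence form,
no new definition) and proves its two structural properties:

* §1 `ofTopSubgroup_hom_resSubgroup_top` — plumbing: `H¹(Γ, X) →res H¹(⊤, X) →ofTop H¹(Γ, X)` is the identity (any
  topological group `Γ`, any `X`).
* §2 (any field `K`) `map_kummerClassTorsion_of_coe_eq` / `map_kummerMapTorsion_of_mul_eq` — Kummer classes and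
  Kummer MAPS under a change of level `F : W[n′] → W[n]`, `T ↦ c • T`, `n·c = n′`: `H¹(F)(κ_{n′}(P)) = κ_n(P)` (the
  global twin of the tree's local `map_localKummerMap_of_coe_eq`; Milne ADT I.6.9 «`b_{v,1} ↦ b_v`»);
  `reduceTorsionH1_resSubgroup_kummerMapTorsion` — restricted to the subgroup `⊤ ≤ Γ_K`, the classes
  `κ_{p^k}(P)|_⊤ ∈ H¹(⊤, W[p^k])` form a `p_*`-COMPATIBLE FAMILY (`WeierstrassCurve.reduceTorsionH1`).
* §3 (`K = ℚ`) `exists_forall_ofTopSubgroup_reduceH1Pk_eq_kummerMapTorsion` — for every `P ∈ W(ℚ)` there is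
  `x ∈ H¹(⊤, T_pW)` with `ofTop(red_{p^k} x) = κ_{p^k}(P)` for all `k` (Rubin B.2.3 applied to the family of §2);
  `eq_of_forall_ofTopSubgroup_reduceH1Pk_eq` — such an `x` is unique; `eq_zero_iff_forall_kummerMapTorsion_eq_zero`;
  `exists_addMonoidHom_kummerTate` — the classes assemble to an additive map `κ_∞ : W(ℚ) →+ H¹(⊤, T_pW)`.
* §4 `locModPk_eq_localKummerMap_of_forall_eq` — `loc_p(x) mod p^k` is the LOCAL Kummer class of `P` read in
  `W(ℚ_v)`, `v = (p)` (localisation of global Kummer classes, AEC X.§4 (**), tree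
  `res_kummerMapTorsion_eq_localKummerMap`); hence `hasLocPKummerLog_of_forall_eq`:
  **`HasLocPKummerLog W p x (log_ω P)`** with multiplier `m = 1` and witness point `P` itself read in `W(ℚ_p)`
  (`log_ω = padicLogLocal`, the logarithm of the Néron differential, `W` globally minimal); packaged with §3 as
  `exists_kummerTate_hasLocPKummerLog` and `exists_addMonoidHom_kummerTate_hasLocPKummerLog`.

USE (successor seats, COUNT-EC⁰ / PR-INV lane): with `κ_∞ = exists_addMonoidHom_kummerTate_hasLocPKummerLog`, the
Kummer-logarithm functional of Parts 8–10 takes the value `log_ω(P)` on `κ_∞(P)` (up to the torsion multiplier of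
`HasLocPKummerLog.unique`), which is the class against which `[A : ℤ_p·z]` and `v₀` of COUNT-EC⁰ are measured
(Kato §14.18, proof of Thm. 14.16 (2) in rank one; potss memo KMC-DESCENT-MEMO §4 (R1-c)).

HONEST LABEL: theorems only; no stub or item is closed; nothing is registered; nothing is asserted on 19945 / 19223;
Kato's Main Conjecture and Perrin-Riou's conjecture are not touched; BSD is not proved for any curve.

References: [Kato2004Asterisque] §14.1 (p. 235), §8.2 (p. 181), §13.8 (p. 228); [Rubin2000] §1.6.A and App. B
Prop. B.2.3; [PerrinRiou1987BSMF] §0 (p. 401); [SilvermanAEC2009] VIII.§2 (p. 190–191), X.§4 diagram (**);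
[MilneADT2006] Ch. I §6, proof of Prop. 6.9; [BlochKato1990] Def. 3.10 and Ex. 3.11;
[AlpogeBhargavaShnidman2022] App. A §10.1.2 and Thm. 10.8 (a) (p. 33); [SerreGaloisCohomology1997] I §2.2–2.4;
[NeukirchANT1999] Ch. II §2.
-/

noncomputable section

open scoped Classical NumberField ContRepresentation

open WeierstrassCurve Field IsDedekindDomain CategoryTheory Literature.NumberTheory.EllipticCurves
  Literature.NumberTheory.EllipticCurves.Kato2004 Literature.NumberTheory.GaloisRepresentations
  Literature.NumberTheory.EllipticCurves.Kato2004.EulerSystemValues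
open WeierstrassCurve (geomPoints geomTorsion galH1Torsion)

universe u v

namespace Summit.BirchSwinnertonDyer.Rank1Residual.Additive.GlobalKummer

/-! ## §1 Plumbing: `ofTopSubgroup ∘ resSubgroup ⊤ = id` on `H¹` -/

section Top

variable {R : Type v} [Ring R] [TopologicalSpace R] {G : Type u} [Group G] [TopologicalSpace G]
  [IsTopologicalGroup G] (X : TopRep.{u} R G)

/-- **`H¹(G, X) →res H¹(⊤, X) →ofTop H¹(G, X)` is the identity**: on continuous crossed homomorphisms both maps are
pull-backs (along `⊤ ↪ G` and `G ≅ ⊤`), whose composite is the identity of `G`.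
[cite: SerreGaloisCohomology1997, I §2.4] -/
theorem ofTopSubgroup_hom_resSubgroup_top (c : continuousCohomology 1 X) :
    (ofTopSubgroup X 1).hom (resSubgroup X ⊤ 1 c) = c := by
  obtain ⟨ψ, rfl⟩ := oneCocycleClass_surjective X c
  rw [resSubgroup_oneCocycleClass]
  change ContinuousCohomology.map toTopSubgroupHom (X := subgroupRep X ⊤) (Y := X)
      (TopRep.ofHom ⟨ContinuousLinearMap.id R X, fun _ => rfl⟩) 1 (oneCocycleClass _ _) = _
  rw [map_oneCocycleClass]
  exact congrArg _ (Subtype.ext (ContinuousMap.ext fun _ ↦ rfl))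

end Top

/-! ## §2 Kummer classes under a change of level; the `p_*`-compatible family `(κ_{p^k}(P)|_⊤)_k` -/

section Level

variable {K : Type u} [Field K] (W : WeierstrassCurve K) {n n' : ℤ} (c : ℤ)
  (F : (W.torsionGaloisModule n').toContRepresentation →ⁱL (W.torsionGaloisModule n).toContRepresentation)
  (hF : ∀ T : geomTorsion W n', ((F T : geomTorsion W n) : geomPoints W) = c • (T : geomPoints W))

include hF in
/-- **Kummer classes under a change of level** `F : W[n′] → W[n]`, `T ↦ c • T`: `H¹(F)(κ_{n′}(Q)) = κ_n(c • Q)` for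
`Q ∈ W(K̄)` with `n′ • Q ∈ W(K)` — the cocycle `σ ↦ σQ − Q` is carried to `σ ↦ σ(cQ) − cQ` (the tree's
`map_torsionMulBy_kummerClassTorsion` for an abstract `F`; global twin of `map_localKummerClass_of_coe_eq`).
[cite: SilvermanAEC2009, VIII.§2 (p. 191)] [cite: MilneADT2006, Ch. I §6, proof of Prop. 6.9] -/
theorem map_kummerClassTorsion_of_coe_eq (Q : geomPoints W)
    (hQ : n' • Q ∈ MulAction.fixedPoints (absoluteGaloisGroup K) (geomPoints W))
    (hQ' : n • (c • Q) ∈ MulAction.fixedPoints (absoluteGaloisGroup K) (geomPoints W)) :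
    galoisCohomology.map F 1 (kummerClassTorsion W n' Q hQ) = kummerClassTorsion W n (c • Q) hQ' := by
  unfold kummerClassTorsion
  refine (galoisCohomology.map_one_oneCocycleClass F (kummerCocycleTorsion W n' Q hQ)).trans ?_
  congr 1
  apply Subtype.ext
  ext σ : 1
  apply Subtype.ext
  change ((F ((kummerCocycleTorsion W n' Q hQ).1 σ) : geomTorsion W n) : geomPoints W) = σ • (c • Q) - c • Q
  rw [hF, coe_kummerCocycleTorsion_apply, zsmul_sub, smul_zsmul_geomPoints]

include hF in
/-- **Kummer MAPS under a change of level**: for `n·c = n′`, `H¹(F)(κ_{n′}(P)) = κ_n(P)` on `W(K)` (`κ_{n′}(P)` is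
the class of a root `R`, `n′R = P`, and `n • (c • R) = P`, so `H¹(F)(κ_{n′}(P))` is the level-`n` class of the root
`c • R` of `P`; the Kummer map does not depend on the root). Milne's «`b_{v,1} ↦ b_v`».
[cite: MilneADT2006, Ch. I §6, proof of Prop. 6.9] [cite: SilvermanAEC2009, VIII.§2 (p. 191)] -/
theorem map_kummerMapTorsion_of_mul_eq (hcn : n * c = n')
    (hdiv' : ∀ P : geomPoints W, ∃ Q : geomPoints W, n' • Q = P)
    (hdiv : ∀ P : geomPoints W, ∃ Q : geomPoints W, n • Q = P) (P : W.toAffine.Point) :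
    galoisCohomology.map F 1 (kummerMapTorsion W n' hdiv' P) = kummerMapTorsion W n hdiv P := by
  have hR' : n • (c • zsmulRoot W n' hdiv' P) = toGeomPoints W P := by
    rw [smul_smul, hcn, zsmul_zsmulRoot]
  rw [kummerMapTorsion_apply, kummerMapTorsion_apply W n, kummerMapTorsionFun_eq W n hdiv P _ hR']
  exact map_kummerClassTorsion_of_coe_eq W c F hF _ _ _

end Level

section Family

variable {K : Type u} [Field K] (W : WeierstrassCurve K) (p k : ℕ)

/-- **The restricted Kummer class on cocycles**: `κ_n(Q)|_⊤ = [σ ↦ σQ − Q]` in `H¹(⊤, W[n])` (restriction to the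
subgroup `⊤ ≤ Γ_K` is the pull-back of cocycles). [cite: SerreGaloisCohomology1997, I §2.4] -/
theorem resSubgroup_top_kummerClassTorsion (n : ℤ) (Q : geomPoints W)
    (hQ : n • Q ∈ MulAction.fixedPoints (absoluteGaloisGroup K) (geomPoints W)) :
    resSubgroup (W.torsionGaloisModule n).toTopRep ⊤ 1 (kummerClassTorsion W n Q hQ) =
      oneCocycleClass (subgroupRep (W.torsionGaloisModule n).toTopRep ⊤)
        (contOneCocycles.pullback (subgroupSubtypeHom ⊤) (X := (W.torsionGaloisModule n).toTopRep)
          (Y := subgroupRep (W.torsionGaloisModule n).toTopRep ⊤)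
          (TopRep.ofHom ⟨ContinuousLinearMap.id ℤ _, fun _ => rfl⟩) (kummerCocycleTorsion W n Q hQ)) :=
  map_oneCocycleClass _ _ _ _

end Family

section FamilyRat

variable (W : WeierstrassCurve ℚ) (p k : ℕ)

/-- **The classes `κ_{p^k}(P)|_⊤ ∈ H¹(⊤, W[p^k])` form a `p_*`-compatible family**:
`p_*(κ_{p^{k+1}}(P)|_⊤) = κ_{p^k}(P)|_⊤` for the transition map `reduceTorsionH1` (`[φ] ↦ [p • φ]`): with a root `R`,
`p^{k+1}R = P`, the left side is `[σ ↦ p(σR − R)] = [σ ↦ σ(pR) − pR]`, the level-`p^k` class of the root `pR` of `P`.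
[cite: PerrinRiou1987BSMF, §0 (p. 401)] [cite: MilneADT2006, Ch. I §6, proof of Prop. 6.9] -/
theorem reduceTorsionH1_resSubgroup_kummerMapTorsion
    (hdiv' : ∀ P : geomPoints W, ∃ Q : geomPoints W, ((p : ℤ) ^ (k + 1)) • Q = P)
    (hdiv : ∀ P : geomPoints W, ∃ Q : geomPoints W, ((p : ℤ) ^ k) • Q = P) (P : W.toAffine.Point) :
    W.reduceTorsionH1 p k ⊤
        (resSubgroup (W.torsionGaloisModule ((p : ℤ) ^ (k + 1))).toTopRep ⊤ 1
          (kummerMapTorsion W ((p : ℤ) ^ (k + 1)) hdiv' P)) =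
      resSubgroup (W.torsionGaloisModule ((p : ℤ) ^ k)).toTopRep ⊤ 1
        (kummerMapTorsion W ((p : ℤ) ^ k) hdiv P) := by
  have hR' : ((p : ℤ) ^ k) • ((p : ℤ) • zsmulRoot W ((p : ℤ) ^ (k + 1)) hdiv' P) = toGeomPoints W P := by
    rw [smul_smul, ← pow_succ, zsmul_zsmulRoot]
  rw [kummerMapTorsion_apply, kummerMapTorsion_apply W ((p : ℤ) ^ k),
    kummerMapTorsionFun_eq W ((p : ℤ) ^ k) hdiv P _ hR']
  unfold kummerMapTorsionFun
  rw [resSubgroup_top_kummerClassTorsion, resSubgroup_top_kummerClassTorsion, reduceTorsionH1_oneCocycleClass]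
  refine congrArg _ (Subtype.ext (ContinuousMap.ext fun g ↦ Subtype.ext ?_))
  change (p : ℤ) • ((g : absoluteGaloisGroup ℚ) • zsmulRoot W ((p : ℤ) ^ (k + 1)) hdiv' P -
      zsmulRoot W ((p : ℤ) ^ (k + 1)) hdiv' P) =
    (g : absoluteGaloisGroup ℚ) • ((p : ℤ) • zsmulRoot W ((p : ℤ) ^ (k + 1)) hdiv' P) -
      (p : ℤ) • zsmulRoot W ((p : ℤ) ^ (k + 1)) hdiv' P
  rw [zsmul_sub, smul_zsmul_geomPoints]

end FamilyRat

/-! ## §3 The `T_p`-adic Kummer class of a rational point (`K = ℚ`) -/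

section Tate

variable (W : WeierstrassCurve ℚ) [W.IsElliptic] (p : ℕ) [Fact p.Prime] [ContinuousSMul ℤ_[p] (W.tateModule p)]

/-- **Existence, `⊤`-typing**: for `P ∈ W(ℚ)` there is `x ∈ H¹(⊤, T_pW)` whose reduction modulo `p^k`
(`Kato2004.reduceH1Pk`) is the restricted Kummer class `κ_{p^k}(P)|_⊤` for every `k` — Rubin B.2.3 (surjectivity of
`H¹(⊤, T_pW) → lim←_k H¹(⊤, W[p^k])`, tree `exists_reduceH1Pk_eq_of_compatible`) applied to the `p_*`-compatible family
of §2. [cite: Rubin2000, App. B Prop. B.2.3] [cite: Kato2004Asterisque, §14.1 (p. 235)] -/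
theorem exists_forall_reduceH1Pk_eq_resSubgroup_kummerMapTorsion
    (hdiv : ∀ (k : ℕ) (P : geomPoints W), ∃ Q : geomPoints W, ((p : ℤ) ^ k) • Q = P) (P : W.toAffine.Point) :
    ∃ x : H1 (tateRep W p) ⊤, ∀ k : ℕ,
      reduceH1Pk W p k ⊤ x =
        resSubgroup (W.torsionGaloisModule ((p : ℤ) ^ k)).toTopRep ⊤ 1
          (kummerMapTorsion W ((p : ℤ) ^ k) (hdiv k) P) :=
  exists_reduceH1Pk_eq_of_compatible W p ⊤
    (fun k ↦ resSubgroup (W.torsionGaloisModule ((p : ℤ) ^ k)).toTopRep ⊤ 1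
      (kummerMapTorsion W ((p : ℤ) ^ k) (hdiv k) P))
    fun k ↦ reduceTorsionH1_resSubgroup_kummerMapTorsion W p k (hdiv (k + 1)) (hdiv k) P

/-- **THE `T_p`-ADIC KUMMER CLASS OF A RATIONAL POINT (existence)**: for `P ∈ W(ℚ)` there is `x ∈ H¹(⊤, T_pW)`
(`= H¹(ℚ, T_pW)`) with `ofTop(red_{p^k} x) = κ_{p^k}(P) ∈ H¹(ℚ, W[p^k])` for EVERY `k` — the image of `P` under
`W(ℚ) → lim←_k W(ℚ)/p^k → lim←_k H¹(ℚ, W[p^k]) = H¹(ℚ, T_pW)` (Kato's `E(ℚ) ⊗ ℤ_p → H¹(ℤ[1/p], T)` composed to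
`H¹(ℚ, T)`). [cite: Kato2004Asterisque, §14.1 (p. 235)] [cite: Rubin2000, §1.6.A and App. B Prop. B.2.3]
[cite: PerrinRiou1987BSMF, §0 (p. 401)] -/
theorem exists_forall_ofTopSubgroup_reduceH1Pk_eq_kummerMapTorsion
    (hdiv : ∀ (k : ℕ) (P : geomPoints W), ∃ Q : geomPoints W, ((p : ℤ) ^ k) • Q = P) (P : W.toAffine.Point) :
    ∃ x : H1 (tateRep W p) ⊤, ∀ k : ℕ,
      (ofTopSubgroup (W.torsionGaloisModule ((p : ℤ) ^ k)).toTopRep 1).hom (reduceH1Pk W p k ⊤ x) =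
        kummerMapTorsion W ((p : ℤ) ^ k) (hdiv k) P := by
  obtain ⟨x, hx⟩ := exists_forall_reduceH1Pk_eq_resSubgroup_kummerMapTorsion W p hdiv P
  exact ⟨x, fun k ↦ by rw [hx k]; exact ofTopSubgroup_hom_resSubgroup_top _ _⟩

/-- **Uniqueness**: a class of `H¹(⊤, T_pW)` is determined by the images `ofTop(red_{p^k} x) ∈ H¹(ℚ, W[p^k])`,
`k ≥ 0` (`ofTop` is injective, tree `eq_zero_of_ofTopSubgroup_eq_zero`; `⋂_k ker red_{p^k} = 0`, tree
`eq_of_forall_reduceH1Pk_eq`). In particular the `T_p`-adic Kummer class of `P` is unique.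
[cite: Rubin2000, App. B Prop. B.2.3] [cite: SerreGaloisCohomology1997, I §2.4] -/
theorem eq_of_forall_ofTopSubgroup_reduceH1Pk_eq {x y : H1 (tateRep W p) ⊤}
    (h : ∀ k : ℕ,
      (ofTopSubgroup (W.torsionGaloisModule ((p : ℤ) ^ k)).toTopRep 1).hom (reduceH1Pk W p k ⊤ x) =
        (ofTopSubgroup (W.torsionGaloisModule ((p : ℤ) ^ k)).toTopRep 1).hom (reduceH1Pk W p k ⊤ y)) :
    x = y := by
  refine eq_of_forall_reduceH1Pk_eq W p ⊤ fun k ↦ ?_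
  rw [← sub_eq_zero, ← map_sub]
  refine eq_zero_of_ofTopSubgroup_eq_zero (W.torsionGaloisModule ((p : ℤ) ^ k)).toTopRep _ ?_
  rw [map_sub, map_sub, sub_eq_zero]
  exact h k

/-- **The `T_p`-adic Kummer class vanishes iff every finite-level Kummer class does** (`⇐`: uniqueness; `⇒`:
`κ_{p^k}(P) = ofTop(red_{p^k} 0) = 0`), i.e. iff `P ∈ p^k W(ℚ)` for every `k` (tree `kummerMapTorsion_ker`).
[cite: SilvermanAEC2009, VIII.§2 (p. 191)] [cite: Rubin2000, App. B Prop. B.2.3] -/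
theorem eq_zero_iff_forall_kummerMapTorsion_eq_zero
    (hdiv : ∀ (k : ℕ) (P : geomPoints W), ∃ Q : geomPoints W, ((p : ℤ) ^ k) • Q = P) {P : W.toAffine.Point}
    {x : H1 (tateRep W p) ⊤}
    (hx : ∀ k : ℕ,
      (ofTopSubgroup (W.torsionGaloisModule ((p : ℤ) ^ k)).toTopRep 1).hom (reduceH1Pk W p k ⊤ x) =
        kummerMapTorsion W ((p : ℤ) ^ k) (hdiv k) P) :
    x = 0 ↔ ∀ k : ℕ, kummerMapTorsion W ((p : ℤ) ^ k) (hdiv k) P = 0 := by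
  constructor
  · rintro rfl k
    rw [← hx k, map_zero, map_zero]
    rfl
  · intro h
    exact eq_of_forall_ofTopSubgroup_reduceH1Pk_eq W p fun k ↦ by rw [hx k, h k, map_zero, map_zero]; rfl

omit [W.IsElliptic] in
/-- Additivity of the finite-level Kummer map over `ℚ`, read with the ambient (decidable) group law of `W(ℚ)`: the
type of the tree's `kummerMapTorsion` (stated over a general field) carries the classical `DecidableEq`, the two
decidability instances on `ℚ` agree (subsingleton). [cite: SilvermanAEC2009, VIII.§2 (p. 190–191)] -/
theorem kummerMapTorsion_add' {n : ℤ} (hdiv : ∀ P : geomPoints W, ∃ Q : geomPoints W, n • Q = P)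
    (a b : W.toAffine.Point) :
    kummerMapTorsion W n hdiv (a + b) = kummerMapTorsion W n hdiv a + kummerMapTorsion W n hdiv b := by
  have h := @AddHom.map_add' _ _ (_) (_) (@AddMonoidHom.toAddHom _ _ (_) (_) (kummerMapTorsion W n hdiv)) a b
  change kummerMapTorsion W n hdiv _ = kummerMapTorsion W n hdiv _ + kummerMapTorsion W n hdiv _ at h
  convert h
  rw [show (instDecidableEqRat : DecidableEq ℚ) = (fun a b ↦ Classical.propDecidable (a = b)) from
    Subsingleton.elim _ _]
  rfl

/-- **The `T_p`-adic Kummer MAP `κ_∞ : W(ℚ) →+ H¹(⊤, T_pW)`** (existence form): the classes of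
`exists_forall_ofTopSubgroup_reduceH1Pk_eq_kummerMapTorsion` are additive in `P` (uniqueness, and additivity of the
finite-level Kummer maps). [cite: Kato2004Asterisque, §14.1 (p. 235)] [cite: Rubin2000, §1.6.A]
[cite: SilvermanAEC2009, VIII.§2 (p. 190–191)] -/
theorem exists_addMonoidHom_kummerTate
    (hdiv : ∀ (k : ℕ) (P : geomPoints W), ∃ Q : geomPoints W, ((p : ℤ) ^ k) • Q = P) :
    ∃ κ : W.toAffine.Point →+ H1 (tateRep W p) ⊤, ∀ (P : W.toAffine.Point) (k : ℕ),
      (ofTopSubgroup (W.torsionGaloisModule ((p : ℤ) ^ k)).toTopRep 1).hom (reduceH1Pk W p k ⊤ (κ P)) =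
        kummerMapTorsion W ((p : ℤ) ^ k) (hdiv k) P := by
  choose f hf using fun P ↦ exists_forall_ofTopSubgroup_reduceH1Pk_eq_kummerMapTorsion W p hdiv P
  refine ⟨AddMonoidHom.mk' f fun P Q ↦ ?_, fun P k ↦ hf P k⟩
  refine eq_of_forall_ofTopSubgroup_reduceH1Pk_eq W p fun k ↦ ?_
  rw [hf, kummerMapTorsion_add' W, map_add, map_add, hf, hf]
  rfl

end Tate

/-! ## §4 Localisation at `p`: `HasLocPKummerLog W p κ_∞(P) (log_ω P)` -/

section Log

variable (W : WeierstrassCurve ℚ) [W.IsElliptic] (p : ℕ) [Fact p.Prime] [ContinuousSMul ℤ_[p] (W.tateModule p)]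

/-- **`loc_p(κ_∞(P)) mod p^k` is the LOCAL Kummer class of `P`**: for `x` with `ofTop(red_{p^k} x) = κ_{p^k}(P)`,
`locModPk W p k x = κ_{p^k, ℚ_v}(P_v)`, `v = (p)`, `P_v` the base change of `P` to `W(ℚ_v)` (localisation of global
Kummer classes is the local Kummer map of the base-changed point, AEC X.§4 left square of (**), tree
`res_kummerMapTorsion_eq_localKummerMap`). [cite: SilvermanAEC2009, X.§4 diagram (**)]
[cite: AlpogeBhargavaShnidman2022, App. A §10.1.2 (p. 33)] -/
theorem locModPk_eq_localKummerMap_of_forall_eq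
    (hdiv : ∀ (k : ℕ) (P : geomPoints W), ∃ Q : geomPoints W, ((p : ℤ) ^ k) • Q = P) {P : W.toAffine.Point}
    {x : H1 (tateRep W p) ⊤}
    (hx : ∀ k : ℕ,
      (ofTopSubgroup (W.torsionGaloisModule ((p : ℤ) ^ k)).toTopRep 1).hom (reduceH1Pk W p k ⊤ x) =
        kummerMapTorsion W ((p : ℤ) ^ k) (hdiv k) P) (k : ℕ) :
    locModPk W p k x =
      W.localKummerMap ((primePlace p).adicCompletion ℚ)
        (pow_ne_zero k (Int.natCast_ne_zero.mpr (Fact.out : p.Prime).ne_zero))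
        (Affine.Point.baseChange (W' := W) ℚ ((primePlace p).adicCompletion ℚ) P) := by
  rw [locModPk_apply, hx k]
  exact Rank1Residual.X11b.KummerIndex.res_kummerMapTorsion_eq_localKummerMap W
    ((primePlace p).adicCompletion ℚ) _ (hdiv k) P

omit [W.IsElliptic] [ContinuousSMul ℤ_[p] (W.tateModule p)] in
/-- The base change `W(ℚ) → W(ℚ_v)`, `v = (p)`, factors through `W(ℚ_p)` along `ℚ_p ≅ ℚ_v` (`padicToAdic`): the
point of `W(ℚ_v)` underlying `P` is `padicToAdic` of the point of `W(ℚ_p)` underlying `P` (Mathlib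
`Affine.Point.map_baseChange`). [cite: NeukirchANT1999, Ch. II §2 (`ℚ_p` as a completion)] -/
theorem map_padicToAdic_baseChange (P : W.toAffine.Point) :
    Affine.Point.map (W' := W) (padicToAdic p) (Affine.Point.baseChange (W' := W) ℚ ℚ_[p] P) =
      Affine.Point.baseChange (W' := W) ℚ ((primePlace p).adicCompletion ℚ) P :=
  Affine.Point.map_baseChange (W' := W) (padicToAdic p) P

/-- **`HasLocPKummerLog W p κ_∞(P) (log_ω P)`**: for `W` globally minimal and `x ∈ H¹(⊤, T_pW)` with
`ofTop(red_{p^k} x) = κ_{p^k}(P)` for all `k`, the localisation at `p` of `x` is a Kummer class with formal-group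
logarithm `log_ω(P)` — witnessed with multiplier `m = 1` and the point `P` itself read in `W(ℚ_p)`: at every level
`loc_p(x) mod p^k = κ_{p^k,ℚ_v}(P_v)` (§4), and `log_ω(P_p) = 1 · log_ω(P_p)`. (Bloch–Kato Ex. 3.11: the Kummer image of
`E(ℚ) ⊗ ℚ_p` lies in `H¹_f(ℚ_p, V)`, with `log` the logarithm of the Néron differential.)
[cite: BlochKato1990, Def. 3.10 and Ex. 3.11] [cite: AlpogeBhargavaShnidman2022, App. A §10.1.2 and Thm. 10.8 (a) (p. 33)]
[cite: Kato2004Asterisque, §14.1 (p. 235)] -/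
theorem hasLocPKummerLog_of_forall_eq [W.IsGloballyMinimal]
    (hdiv : ∀ (k : ℕ) (P : geomPoints W), ∃ Q : geomPoints W, ((p : ℤ) ^ k) • Q = P) {P : W.toAffine.Point}
    {x : H1 (tateRep W p) ⊤}
    (hx : ∀ k : ℕ,
      (ofTopSubgroup (W.torsionGaloisModule ((p : ℤ) ^ k)).toTopRep 1).hom (reduceH1Pk W p k ⊤ x) =
        kummerMapTorsion W ((p : ℤ) ^ k) (hdiv k) P) :
    HasLocPKummerLog W p x
      (padicLogLocal W p (Affine.Point.map (W' := W.toAffine) (S := ℚ) (Algebra.ofId ℚ ℚ_[p]) P)) := by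
  refine ⟨1, Affine.Point.map (W' := W.toAffine) (S := ℚ) (Algebra.ofId ℚ ℚ_[p]) P, one_ne_zero,
    fun k ↦ ?_, by rw [Nat.cast_one, one_mul]⟩
  rw [one_nsmul, locModPk_eq_localKummerMap_of_forall_eq W p hdiv hx k]
  congr 1
  exact (map_padicToAdic_baseChange W p P).symm

/-- **THE `T_p`-ADIC KUMMER CLASS OF `P` WITH ITS LOGARITHM** (package): for `W/ℚ` globally minimal, any prime `p`
and `P ∈ W(ℚ)` there is `x ∈ H¹(⊤, T_pW)` with `ofTop(red_{p^k} x) = κ_{p^k}(P)` for all `k` AND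
`HasLocPKummerLog W p x (log_ω P)` (divisibility of `W(ℚ̄)` from the tree's `zsmul_geomPoints_surjective_holds`).
[cite: Kato2004Asterisque, §14.1 (p. 235)] [cite: BlochKato1990, Ex. 3.11] [cite: Rubin2000, App. B Prop. B.2.3] -/
theorem exists_kummerTate_hasLocPKummerLog [W.IsGloballyMinimal] (P : W.toAffine.Point) :
    ∃ x : H1 (tateRep W p) ⊤,
      (∀ k : ℕ,
        (ofTopSubgroup (W.torsionGaloisModule ((p : ℤ) ^ k)).toTopRep 1).hom (reduceH1Pk W p k ⊤ x) =
          kummerMapTorsion W ((p : ℤ) ^ k)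
            (fun R ↦ zsmul_geomPoints_surjective_holds W
              (pow_ne_zero k (Int.natCast_ne_zero.mpr (Fact.out : p.Prime).ne_zero)) R) P) ∧
      HasLocPKummerLog W p x
        (padicLogLocal W p (Affine.Point.map (W' := W.toAffine) (S := ℚ) (Algebra.ofId ℚ ℚ_[p]) P)) := by
  obtain ⟨x, hx⟩ := exists_forall_ofTopSubgroup_reduceH1Pk_eq_kummerMapTorsion W p
    (fun k R ↦ zsmul_geomPoints_surjective_holds W
      (pow_ne_zero k (Int.natCast_ne_zero.mpr (Fact.out : p.Prime).ne_zero)) R) P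
  exact ⟨x, hx, hasLocPKummerLog_of_forall_eq W p _ hx⟩

/-- **THE `T_p`-ADIC KUMMER MAP WITH ITS LOGARITHMS** (package): for `W/ℚ` globally minimal and any prime `p` there
is an additive `κ_∞ : W(ℚ) →+ H¹(⊤, T_pW)` with `ofTop(red_{p^k} κ_∞(P)) = κ_{p^k}(P)` for all `P`, `k`, and
`HasLocPKummerLog W p (κ_∞ P) (log_ω P)` for every `P ∈ W(ℚ)` — Kato's `E(ℚ) ⊗ ℤ_p → H¹(ℚ, T)` composed with
Bloch–Kato's `log ∘ loc_p`, in the tree's finite-level currency. [cite: Kato2004Asterisque, §14.1 (p. 235)]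
[cite: BlochKato1990, Ex. 3.11] [cite: AlpogeBhargavaShnidman2022, App. A Thm. 10.8 (a) (p. 33)] -/
theorem exists_addMonoidHom_kummerTate_hasLocPKummerLog [W.IsGloballyMinimal] :
    ∃ κ : W.toAffine.Point →+ H1 (tateRep W p) ⊤,
      (∀ (P : W.toAffine.Point) (k : ℕ),
        (ofTopSubgroup (W.torsionGaloisModule ((p : ℤ) ^ k)).toTopRep 1).hom (reduceH1Pk W p k ⊤ (κ P)) =
          kummerMapTorsion W ((p : ℤ) ^ k)
            (fun R ↦ zsmul_geomPoints_surjective_holds W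
              (pow_ne_zero k (Int.natCast_ne_zero.mpr (Fact.out : p.Prime).ne_zero)) R) P) ∧
      ∀ P : W.toAffine.Point, HasLocPKummerLog W p (κ P)
        (padicLogLocal W p (Affine.Point.map (W' := W.toAffine) (S := ℚ) (Algebra.ofId ℚ ℚ_[p]) P)) := by
  obtain ⟨κ, hκ⟩ := exists_addMonoidHom_kummerTate W p
    (fun k R ↦ zsmul_geomPoints_surjective_holds W
      (pow_ne_zero k (Int.natCast_ne_zero.mpr (Fact.out : p.Prime).ne_zero)) R)
  exact ⟨κ, hκ, fun P ↦ hasLocPKummerLog_of_forall_eq W p _ (hκ P)⟩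

end Log

end Summit.BirchSwinnertonDyer.Rank1Residual.Additive.GlobalKummer

end
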